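import Summits.MatrixMultiplication.MatrixMultiplication.Theorems.SoloInformedSliceTransfer

/-!
# The self-similar door for `T_cw,2` is vacuous — `⟨3⟩ ⊠ T_cw,2^{⊠n} (⊕ ⟨0⟩) ⋭ T_cw,2^{⊠(n+1)}`

Solo seat `solo-MatrixMultiplication-informed` (generation 38); companion to
`SoloInformedKroneckerCatalystVacuous.lean` (Theorem E′).  The kernel door D11
`matrixMultiplication_of_cwTensor_two_selfSimilar` (`SoloInformedKroneckerCatalyst.lean`) derives
`ω = 2` from ONE exact self-similar degeneration

  `⟨3⟩ ⊠ T_cw,2^{⊠n} ⊕ ⟨0⟩ ⊵ T_cw,2^{⊠(n+1)}`   (some `n`).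

**Theorem** (`not_algDegeneratesTo_selfSimilar_cwTensor_two`, every field, every `n`): no such
degeneration exists; hence the door's hypothesis is unsatisfiable (`selfSimilar_door_vacuous`).

Proof (slice ranks, as for Theorem E′; files `SoloInformedSliceRank.lean`,
`SoloInformedSliceTransfer.lean`).
* TARGET: every non-zero first-factor slice of `T_cw,2^{⊠N}` has rank `≥ 2^N`
  (`minSliceRank_kroneckerPow_cwTensor_two`, from `⟨1⟩` by the doubling lemma).
* SOURCE: the coordinate slice of `⟨3⟩ ⊠ T_cw,2^{⊠n}` at `e_0 ⊗ e_0^{⊗n}` is supported on the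
  `2^n` columns `(0, c)` with `c ∈ {1,2}^n`, so it has rank `≤ 2^n < 2^{n+1}`
  (`rank_le_card_of_cols`, `rank_coordSlice_three_kroneckerPow_le`); the summand `⟨0⟩` is removed
  by a restriction (`tensorRestrictsTo_directSum_unitTensor_zero`).
* Both first index sets have `3^{n+1}` elements, so the TRANSFER LEMMA
  (`not_algDegeneratesTo_of_minSliceRank`) forbids the degeneration.

HONEST FRAMING: this settles nothing about `ω`; like Theorem E′ it shows that an exact (`E = 0`,
no format slack) certificate for `σ(T_cw,2) = 3` of this particular shape does not exist.

[cite: Landsberg2017, Prop. 5.2.1.2]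
[cite: BurgisserClausenShokrollahi1997, (15.19)]
[cite: ChristandlVranaZuiddam2023, §1.1]
-/

set_option linter.dupNamespace false
set_option linter.unusedSectionVars false

noncomputable section

namespace Summit.MatrixMultiplication.MatrixMultiplication.Theorems

open Literature.Computability.AlgebraicComplexity
open scoped BigOperators Matrix

namespace SliceRank

variable {K : Type*} [Field K]

/-! ## A rank bound by column support -/

section ColumnSupport

variable {m n : Type*} [Fintype m] [Fintype n] [DecidableEq n]

/-- A matrix whose columns outside a finite set `S` vanish has rank `≤ |S|`: it factors through
its `S`-columns, `M = M|_S · E_S`. [cite: HornJohnson2013, §0.4.4 (d)] -/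
theorem rank_le_card_of_cols (M : Matrix m n K) (S : Finset n)
    (h : ∀ j, j ∉ S → ∀ i, M i j = 0) : M.rank ≤ S.card := by
  set E : Matrix S n K := fun s j => if (s : n) = j then 1 else 0 with hE
  have hM : M = M.submatrix id (fun s : S => (s : n)) * E := by
    ext i j
    rw [Matrix.mul_apply]
    by_cases hj : j ∈ S
    · rw [Finset.sum_eq_single (⟨j, hj⟩ : S) (fun s _ hs => ?_) (by simp)]
      · simp [hE]
      · have : (s : n) ≠ j := fun h' => hs (Subtype.ext h')
        simp [hE, this]
    · rw [h j hj i]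
      symm
      refine Finset.sum_eq_zero fun s _ => ?_
      have : (s : n) ≠ j := fun h' => hj (h' ▸ s.2)
      simp [hE, this]
  calc M.rank = (M.submatrix id (fun s : S => (s : n)) * E).rank := by rw [← hM]
    _ ≤ (M.submatrix id (fun s : S => (s : n))).rank := Matrix.rank_mul_le_left _ _
    _ ≤ Fintype.card S := Matrix.rank_le_card_width _
    _ = S.card := Fintype.card_coe S

end ColumnSupport

/-! ## The target: slices of `T_cw,2^{⊠N}` have rank `≥ 2^N` -/

section Target

/-- Every non-zero slice of `⟨1⟩` (a `1 × 1 × 1` tensor with entry `1`) has rank `≥ 1`.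
[folklore] -/
theorem minSliceRank_unitTensor_one : MinSliceRank (unitTensor K 1) 1 := by
  intro γ hγ
  have h0 : γ 0 ≠ 0 := fun h => hγ (funext fun i => by rw [Subsingleton.elim i 0]; simpa using h)
  refine one_le_rank_of_ne_zero fun hM => h0 ?_
  have := congr_fun (congr_fun hM 0) 0
  simpa using this

/-- `α ≃ Fin 1 × α`, `a ↦ (0, a)`. [folklore] -/
def unitProd (α : Type*) : α ≃ Fin 1 × α where
  toFun a := (0, a)
  invFun p := p.2
  left_inv _ := rfl
  right_inv _ := Prod.ext (Subsingleton.elim _ _) rfl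

/-- **Every non-zero first-factor slice of `T_cw,2^{⊠N}` has rank `≥ 2^N`** (`⟨1⟩ ⊠ T_cw,2^{⊠N}`
relabelled; doubling lemma `MinSliceRank.kronecker_kroneckerPow_cwTensor_two`).
[cite: Landsberg2017, Prop. 5.2.1.2] -/
theorem minSliceRank_kroneckerPow_cwTensor_two (N : ℕ) :
    MinSliceRank (kroneckerPow (cwTensor K 2) N) (2 ^ N) := by
  have h := (minSliceRank_unitTensor_one (K := K)).kronecker_kroneckerPow_cwTensor_two N
  rw [mul_one] at h
  exact h.of_reindex (unitProd _) (unitProd _) (unitProd _) fun a b c => by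
    simp [unitProd, kroneckerTensor_apply]

end Target

/-! ## The source: a coordinate slice of `⟨3⟩ ⊠ T_cw,2^{⊠n}` of rank `≤ 2^n` -/

section Source

/-- `T_cw,2 (0, x, 0) = 0` for every `x`. [cite: ConnerGesmundoLandsbergVentura2022, eq. (1)] -/
theorem cwTensor_two_zero_mid_zero (x : Fin 3) : cwTensor K 2 0 x 0 = 0 := by
  fin_cases x <;> simp [cwTensor_apply]

/-- The entry `(⟨3⟩ ⊠ T_cw,2^{⊠n}) ((0, 0⃗), (j, b), (k, c))` vanishes unless `k = 0` and every
`c i ≠ 0`. [cite: ConnerGesmundoLandsbergVentura2022, eq. (1)] -/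
theorem three_kroneckerPow_coord_eq_zero (n : ℕ) (j k : Fin 3) (b c : Fin n → Fin 3)
    (hkc : k ≠ 0 ∨ ∃ i, c i = 0) :
    kroneckerTensor (unitTensor K 3) (kroneckerPow (cwTensor K 2) n)
      ((0 : Fin 3), fun _ => (0 : Fin 3)) (j, b) (k, c) = 0 := by
  simp only [kroneckerTensor_apply, kroneckerPow_apply]
  rcases hkc with hk | ⟨i, hi⟩
  · have : unitTensor K 3 0 j k = 0 := by
      rw [unitTensor_apply, if_neg]
      rintro ⟨rfl, rfl⟩
      exact hk rfl
    rw [this, zero_mul]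
  · rw [Finset.prod_eq_zero (Finset.mem_univ i) (by rw [hi]; exact cwTensor_two_zero_mid_zero _),
      mul_zero]

/-- **The coordinate slice of `⟨3⟩ ⊠ T_cw,2^{⊠n}` at `e_0 ⊗ e_0^{⊗n}` has rank `≤ 2^n`**: its
non-zero columns are among the `2^n` columns `(0, succ ∘ g)`, `g : Fin n → Fin 2`.
[cite: Landsberg2017, Prop. 5.2.1.2] -/
theorem rank_coordSlice_three_kroneckerPow_le (n : ℕ) :
    (slice (kroneckerTensor (unitTensor K 3) (kroneckerPow (cwTensor K 2) n))
      (fun a => if a = ((0 : Fin 3), fun _ => (0 : Fin 3)) then 1 else 0)).rank ≤ 2 ^ n := by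
  classical
  set u := kroneckerTensor (unitTensor K 3) (kroneckerPow (cwTensor K 2) n) with hu
  set a₀ : Fin 3 × (Fin n → Fin 3) := ((0 : Fin 3), fun _ => (0 : Fin 3)) with ha₀
  -- the slice is the coordinate slice `u a₀`
  have hsl : slice u (fun a => if a = a₀ then 1 else 0) = Matrix.of fun bb cc => u a₀ bb cc := by
    ext bb cc
    rw [slice_apply, Matrix.of_apply, Finset.sum_eq_single a₀ (fun a _ ha => by simp [ha])
      (by simp)]
    simp
  -- the admissible columns
  let σ : (Fin n → Fin 2) ↪ Fin 3 × (Fin n → Fin 3) :=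
    ⟨fun g => ((0 : Fin 3), fun i => Fin.succ (g i)), fun g g' hgg' => by
      funext i
      have := congr_fun (Prod.ext_iff.1 hgg').2 i
      exact Fin.succ_injective _ this⟩
  have hcols : ∀ cc, cc ∉ (Finset.univ.map σ) → ∀ bb,
      (Matrix.of fun bb cc => u a₀ bb cc) bb cc = 0 := by
    rintro ⟨k, c⟩ hkc ⟨j, b⟩
    rw [Matrix.of_apply]
    refine three_kroneckerPow_coord_eq_zero n j k b c ?_
    by_contra hcon
    simp only [not_or, not_exists, ne_eq, not_not] at hcon
    apply hkc
    rw [Finset.mem_map]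
    refine ⟨fun i => (Fin.exists_succ_eq.2 (hcon.2 i)).choose, Finset.mem_univ _,
      Prod.ext hcon.1.symm ?_⟩
    funext i
    exact (Fin.exists_succ_eq.2 (hcon.2 i)).choose_spec
  rw [hsl]
  calc (Matrix.of fun bb cc => u a₀ bb cc).rank ≤ (Finset.univ.map σ).card :=
        rank_le_card_of_cols _ _ hcols
    _ = 2 ^ n := by simp [Finset.card_map]

end Source

/-! ## Removing the summand `⟨0⟩` -/

section DirectSumZero

variable {ι κ μ : Type*} [Fintype ι] [Fintype κ] [Fintype μ] [DecidableEq ι] [DecidableEq κ]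
  [DecidableEq μ]

/-- `u ≥ u ⊕ ⟨0⟩` (the direct sum with the empty tensor is a relabelling of `u`).
[cite: ChristandlVranaZuiddam2023, §1.1] -/
theorem tensorRestrictsTo_directSum_unitTensor_zero (u : ι → κ → μ → K) :
    TensorRestrictsTo u (directSumTensor u (unitTensor K 0)) := by
  have e : directSumTensor u (unitTensor K 0) = fun x y z =>
      u (Sum.elim id Fin.elim0 x) (Sum.elim id Fin.elim0 y) (Sum.elim id Fin.elim0 z) := by
    funext x y z
    rcases x with x | x
    · rcases y with y | y
      · rcases z with z | z
        · rfl
        · exact Fin.elim0 z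
      · exact Fin.elim0 y
    · exact Fin.elim0 x
  rw [e]
  exact tensorRestrictsTo_precomp u _ _ _

/-- `u ⊕ ⟨0⟩ ≥ u`. [cite: ChristandlVranaZuiddam2023, §1.1] -/
theorem tensorRestrictsTo_directSum_unitTensor_zero' (u : ι → κ → μ → K) :
    TensorRestrictsTo (directSumTensor u (unitTensor K 0)) u :=
  (tensorRestrictsTo_precomp (directSumTensor u (unitTensor K 0)) Sum.inl Sum.inl Sum.inl :
    TensorRestrictsTo (directSumTensor u (unitTensor K 0)) u)

end DirectSumZero

end SliceRank

/-! ## The theorem -/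

section SelfSimilar

open SliceRank

variable {K : Type*} [Field K]

/-- **The self-similar degeneration does not exist (every field, every `n`).**  There is NO
degeneration `⟨3⟩ ⊠ T_cw,2^{⊠n} ⊕ ⟨0⟩ ⊵ T_cw,2^{⊠(n+1)}`: the target's non-zero slices have
rank `≥ 2^{n+1}`, the source has a non-zero slice of rank `≤ 2^n`, and both first index sets have
`3^{n+1}` elements (transfer lemma). [cite: Landsberg2017, Prop. 5.2.1.2]
[cite: BurgisserClausenShokrollahi1997, (15.19)] -/
theorem not_algDegeneratesTo_selfSimilar_cwTensor_two (n : ℕ) :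
    ¬ AlgDegeneratesTo
        (directSumTensor (kroneckerTensor (unitTensor K 3) (kroneckerPow (cwTensor K 2) n))
          (unitTensor K 0))
        (kroneckerPow (cwTensor K 2) (n + 1)) := by
  classical
  intro hdeg
  have hdeg' : AlgDegeneratesTo (kroneckerTensor (unitTensor K 3) (kroneckerPow (cwTensor K 2) n))
      (kroneckerPow (cwTensor K 2) (n + 1)) :=
    (tensorRestrictsTo_directSum_unitTensor_zero _).algDegeneratesTo_trans hdeg
  have ht := minSliceRank_kroneckerPow_cwTensor_two (K := K) (n + 1)
  have hα₀ : (fun a : Fin 3 × (Fin n → Fin 3) =>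
      if a = ((0 : Fin 3), fun _ => (0 : Fin 3)) then (1 : K) else 0) ≠ 0 := fun h0 =>
    (one_ne_zero : (1 : K) ≠ 0) (by simpa using congr_fun h0 ((0 : Fin 3), fun _ => (0 : Fin 3)))
  have hsrc : (slice (kroneckerTensor (unitTensor K 3) (kroneckerPow (cwTensor K 2) n))
      (fun a => if a = ((0 : Fin 3), fun _ => (0 : Fin 3)) then (1 : K) else 0)).rank <
        2 ^ (n + 1) := by
    have h1 := rank_coordSlice_three_kroneckerPow_le (K := K) n
    have h2 : 2 ^ n < 2 ^ (n + 1) := Nat.pow_lt_pow_right (by norm_num) (Nat.lt_succ_self n)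
    exact h1.trans_lt h2
  have hcard : Fintype.card (Fin (n + 1) → Fin 3) = Fintype.card (Fin 3 × (Fin n → Fin 3)) := by
    simp [Fintype.card_prod, Fintype.card_fin, pow_succ, mul_comm]
  exact not_algDegeneratesTo_of_minSliceRank ht (Fintype.equivOfCardEq hcard) hα₀ hsrc hdeg'

/-- **The self-similar door is vacuous**: the hypothesis of
`matrixMultiplication_of_cwTensor_two_selfSimilar` is unsatisfiable (over `ℂ`; in fact over every
field). [cite: Landsberg2017, Prop. 5.2.1.2] -/
theorem selfSimilar_door_vacuous :
    ¬ ∃ n : ℕ, AlgDegeneratesTo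
        (directSumTensor (kroneckerTensor (unitTensor ℂ 3) (kroneckerPow (cwTensor ℂ 2) n))
          (unitTensor ℂ 0))
        (kroneckerPow (cwTensor ℂ 2) (n + 1)) :=
  fun ⟨n, h⟩ => not_algDegeneratesTo_selfSimilar_cwTensor_two n h

/-- The same without the empty summand: `⟨3⟩ ⊠ T_cw,2^{⊠n} ⋭ T_cw,2^{⊠(n+1)}` for every `n`
(although both have `3^{n+1}` first indices and the quotient of costs `σ(T_cw,2)^{n+1} / (3 σ^n)`
would be `1` if `σ(T_cw,2) = 3`). [cite: Landsberg2017, Prop. 5.2.1.2] -/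
theorem not_algDegeneratesTo_three_kroneckerPow_cwTensor_two (n : ℕ) :
    ¬ AlgDegeneratesTo (kroneckerTensor (unitTensor K 3) (kroneckerPow (cwTensor K 2) n))
        (kroneckerPow (cwTensor K 2) (n + 1)) := fun hdeg =>
  not_algDegeneratesTo_selfSimilar_cwTensor_two n
    ((tensorRestrictsTo_directSum_unitTensor_zero' _).algDegeneratesTo_trans hdeg)

end SelfSimilar

end Summit.MatrixMultiplication.MatrixMultiplication.Theorems

end
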